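import Summits.CriticalPhenomena.PercolationContinuityZ3.Theorems.PercNearOneGluingNoHeavyConstsHardCoreBHK
import Literature.Probability.Percolation.PercolationEvents
import HarnessLib
import HarnessLib.Audit.Tags

/-!
# CONJECTURES "one-copy conditioning" and "cross-reach" — census-clean REFINEMENTS of the fibrewise hard-core Harris
# inequality (HC) / PA-BERN, with the kernel links (PAPER-2 track (ii): constants of the CSH family)

builds on p205010 (kernel theorem, internal audit signed; external expert review pending).  Support file (`--supports
stmt-CriticalPhenomena-4575`), lead seat `prim-nh-lead-4575` (gen 106); memo `run/shared/lean/prim/prim-nh-lead-4575/LEAD-GEN106.md` §2;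
engines + kit bundle `run/shared/lean/prim/prim-nh-lead-4575/lab-gen106/hc/` (`hcsplit*.c`; kit j168587–j168599).  Three `Prop`
definitions (OPEN counting statements, tagged `@[conjecture]`), five theorems; no sorries; standard axioms.

SETTING (as in `…ConstsFibrewiseBHK.lean`, `…ConstsHardCoreBHK.lean`): configurations `a : BondConfig (Fin n)`; a folding fibre
`(M, u)` is the set of `a` with `a \ M = u`, closed under the reflection `a ↦ a ∆ M`; the pairs `(η₀, η₁) = (a, a ∆ M)` are exactly the
pairs of configurations with a fixed two-copy profile.  `C_S(ω) = ⋃_{s∈S} C_s(ω)` is the union edge cluster, `U_P = {P(C_S)}` for an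
increasing predicate `P`; write `N(X ; Y) = #{a : a \ M = u, a ∈ X, a ∆ M ∈ Y}` (swap-symmetric: `N(X;Y) = N(Y;X)`,
`Consts.OneCopy.card_filter_pair_swap`).  Every statement of the family PA-BERN / (HC) reads, on a fibre,
`Σ_{pairs in a σ-symmetric CLASS} ∇p·∇q ≥ 0` with `∇p = 1_P(η₀) − 1_P(η₁)`; in counting form
`N_CLASS(U_P ; U_Q) + N_CLASS(U_Q ; U_P) ≤ N_CLASS(U_P ∩ U_Q ; ⊤) + N_CLASS(⊤ ; U_P ∩ U_Q)`.  CLASS = all pairs is Harris fibrewise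
(Kleitman twice, `Consts.OneCopy.harris_pair`); CLASS = "both copies avoid `T`" is `Consts.FibrewiseBHK` (PA-BERN, open); CLASS = "no
`v ∈ N` is reached in both copies" is `Consts.HardCoreBHK` (open; its `T = ∅` slice (HC) already implies all of it,
`Consts.HardCoreReduction.hardCoreBHK_iff_hardCoreHarris`).
* `Consts.OneCopyRepelBHK` — **CONJECTURE (OPEN, this seat)**, CLASS = "copy 0 avoids `T`" (copy 1 FREE):
  `N(B∩U_P ; U_Q) + N(B∩U_Q ; U_P) ≤ N(B∩U_P∩U_Q ; ⊤) + N(B ; U_P∩U_Q)`, `B = {S ↮ T}`.  MEASURE LEVEL (two independent copies, any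
  weights) this is a THEOREM in three lines: `E⊗E[1_B(ω)(p−p′)(q−q′)] = x₀ − α₀β − β₀α + μ₀x ≥ (α₀ − μ₀α)(β₀ − μ₀β)/μ₀ ≥ 0` by BHK's
  Thm 1.3 (`x₀μ₀ ≥ α₀β₀`), Harris (`x ≥ αβ`) and Harris again (`α₀ ≤ μ₀α`, `β₀ ≤ μ₀β`); the conjecture is the FIBREWISE (coefficientwise
  in the two-copy Bernstein basis) strengthening, exactly as PA-BERN strengthens Thm 1.3.  `T = ∅`: Harris fibrewise
  (`Consts.oneCopyRepelBHK_of_repel_empty`).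
* `Consts.OneCopyContainBHK` — **CONJECTURE (OPEN, this seat)**, CLASS = "copy 0's cluster CONTAINS the vertex set `A`" (copy 1 free);
  `A = ∅`: Harris fibrewise (`Consts.oneCopyContainBHK_of_empty`).
* `Consts.CrossReachBHK` — **CONJECTURE (OPEN, this seat)**, CLASS = "copy 0 misses `v`, copy 1 reaches `v`" (the `w = 1` stratum at a
  hard-core vertex `v`, `w` = number of copies reaching `v`).  KERNEL LINK (`Consts.hardCoreBHK_single_of_crossReach_of_fibrewiseBHK`):
  on every fibre, PA-BERN with `T = {v}` (the `w = 0` stratum) plus `CrossReachBHK` (the `w = 1` stratum) give the hard-core inequality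
  (HC) at `N = {v}` — the `w = 2` stratum is excluded by the hard-core condition — so at a single hard-core vertex (HC) is NOT an
  independent statement: (HC)(v) ⟸ PA-BERN(v) ∧ X(v).
EVIDENCE (exact, every two-copy profile; lead gen 106, engines `hcsplit.c`/`hcsplit2.c`/`hcsplit3.c`/`hcsplit4.c`, validated against
each other on the `n ≤ 4` list, negated controls violate): **0 violations** of the three conjectures for the connection events `{s ↔ x}`
and their OR/AND/size combinations on ALL graphs with `n ≤ 5` (`|S| ≤ 2`; containment/avoidance sets of size ≤ 2; cross-reach with
every extra repelled set `T`: 2.0·10⁸ profile rows) and on all 70 graphs with `n = 6, m ≤ 8` (`|S| ≤ 2`; 1.3·10⁹ rows; one-copy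
avoidance also through nested asymmetric repulsion, 2.15·10⁶ instances); kit j168587–j168599 extend to `n = 6` (all `m`) and
`n = 7, m ≤ 13`.  REFUTED NEIGHBOURS (exact, `n ≤ 5`, so the three statements are the right level): the `w = 2` stratum alone
(`n = 4`); conditioning copy 0 on `{C₀ meets T}`, on `{A ⊄ C₀}`, on a SIZE event `|V(C₀)| ≤ r` / `≥ r`, or on a mixed event
`{x ∈ C₀, v ∉ C₀}`; two-copy MIXED reach types (copy 0 reaches `N₀ ≠ ∅`, copy 1 reaches a disjoint `N₁ ≠ ∅`) and CROSSING repulsion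
(copy 0 avoids `T₀`, copy 1 avoids `T₁`, neither contains the other) — e.g. the path `0-2-4-3-1`, `S = {4}`, `T₀ = {3}`, `T₁ = {2}`,
`p = 4↔0`, `q = 4↔1`; the abstract lattice version of one-copy repulsion (arbitrary up-sets in place of cluster events) fails at `m = 2`;
and at measure level "positive association given `S ↔ v`" is FALSE (`s` joined to `x₁,x₂,x₃`, each joined to `v`; `{s↔x₁}` vs
`{s↔x₂ ∧ s↔x₃}`), so `CrossReachBHK` / `OneCopyContainBHK` are not instances of BHK's Theorem 1.3.
[cite: VandenbergHaggstromKahn2005, Thm. 1.3 (p. 6), Thm. 1.1 (pp. 3–5)] [cite: Linusson2011, Prop. 2.6] [cite: Kleitman1966, Lemma]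
[cite: Harris1960, Lemma 4.1] [status: open]
-/

noncomputable section

namespace Summit.CriticalPhenomena.PercolationContinuityZ3.Theorems

open MeasureTheory Set Literature.Probability.LatticeModels Literature.Probability.Percolation
open scoped Classical symmDiff

namespace Consts

/-! ## Fibre bookkeeping: the reflection swaps the two copies; Harris fibrewise in the symmetric two-sided form -/

namespace OneCopy

variable {ι : Type*} [Fintype ι]

/-- **Swap symmetry of two-copy fibre counts**: `#{a : a \ M = u, X a, Y (a ∆ M)} = #{a : a \ M = u, Y a, X (a ∆ M)}` — the
reflection `a ↦ a ∆ M` is an involution of the folding fibre exchanging the two copies. [cite: Linusson2011, Prop. 2.6] [folklore] -/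
theorem card_filter_pair_swap (M u : Set ι) (X Y : Set ι → Prop) :
    (Finset.univ.filter fun a : Set ι => a \ M = u ∧ X a ∧ Y (a ∆ M)).card =
      (Finset.univ.filter fun a : Set ι => a \ M = u ∧ Y a ∧ X (a ∆ M)).card := by
  refine Finset.card_bij' (fun (a : Set ι) _ => a ∆ M) (fun (a : Set ι) _ => a ∆ M) ?_ ?_ ?_ ?_
  · intro a ha
    simp only [Finset.mem_filter, Finset.mem_univ, true_and] at ha ⊢
    refine ⟨FoldingFibre.mem_fibre.1 (FoldingFibre.symmDiff_mem_fibre (FoldingFibre.mem_fibre.2 ha.1)), ha.2.2, ?_⟩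
    rw [symmDiff_symmDiff_cancel_right]
    exact ha.2.1
  · intro a ha
    simp only [Finset.mem_filter, Finset.mem_univ, true_and] at ha ⊢
    refine ⟨FoldingFibre.mem_fibre.1 (FoldingFibre.symmDiff_mem_fibre (FoldingFibre.mem_fibre.2 ha.1)), ha.2.2, ?_⟩
    rw [symmDiff_symmDiff_cancel_right]
    exact ha.2.1
  · intro a _
    exact symmDiff_symmDiff_cancel_right M a
  · intro a _
    exact symmDiff_symmDiff_cancel_right M a

/-- **Harris fibrewise, two-sided form** ("Kleitman twice", both orientations): for upper sets `A, B` of configurations and every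
folding fibre, `N(A ; B) + N(B ; A) ≤ N(A ∩ B ; ⊤) + N(⊤ ; A ∩ B)`.  Summing the weighted fibres gives `2 μ(A)μ(B) ≤ 2 μ(A ∩ B)`.
[cite: Kleitman1966, Lemma] [cite: Harris1960, Lemma 4.1] [cite: Linusson2011, Prop. 2.6] -/
theorem harris_pair {A B : Set (Set ι)} (hA : IsUpperSet A) (hB : IsUpperSet B) (M u : Set ι) :
    (Finset.univ.filter fun a : Set ι => a \ M = u ∧ a ∈ A ∧ a ∆ M ∈ B).card +
        (Finset.univ.filter fun a : Set ι => a \ M = u ∧ a ∈ B ∧ a ∆ M ∈ A).card ≤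
      (Finset.univ.filter fun a : Set ι => a \ M = u ∧ (a ∈ A ∧ a ∈ B) ∧ a ∆ M ∈ (Set.univ : Set (Set ι))).card +
        (Finset.univ.filter fun a : Set ι => a \ M = u ∧ a ∈ (Set.univ : Set (Set ι)) ∧ (a ∆ M ∈ A ∧ a ∆ M ∈ B)).card := by
  have h1 := FoldingFibre.fibreCount_le_of_isUpperSet hA hB M u
  have h2 := FoldingFibre.fibreCount_le_of_isUpperSet hB hA M u
  have e1 : (Finset.univ.filter fun a : Set ι => a \ M = u ∧ a ∈ A ∩ B ∧ a ∆ M ∈ (Set.univ : Set (Set ι))).card =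
      (Finset.univ.filter fun a : Set ι => a \ M = u ∧ (a ∈ A ∧ a ∈ B) ∧ a ∆ M ∈ (Set.univ : Set (Set ι))).card :=
    congrArg Finset.card (Finset.filter_congr fun a _ => by simp only [Set.mem_inter_iff])
  have e2 : (Finset.univ.filter fun a : Set ι => a \ M = u ∧ a ∈ B ∩ A ∧ a ∆ M ∈ (Set.univ : Set (Set ι))).card =
      (Finset.univ.filter fun a : Set ι => a \ M = u ∧ a ∈ (Set.univ : Set (Set ι)) ∧ (a ∆ M ∈ A ∧ a ∆ M ∈ B)).card := by
    refine Finset.card_bij' (fun (a : Set ι) _ => a ∆ M) (fun (a : Set ι) _ => a ∆ M) ?_ ?_ ?_ ?_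
    · intro a ha
      simp only [Finset.mem_filter, Finset.mem_univ, true_and, Set.mem_inter_iff, Set.mem_univ] at ha ⊢
      refine ⟨FoldingFibre.mem_fibre.1 (FoldingFibre.symmDiff_mem_fibre (FoldingFibre.mem_fibre.2 ha.1)), ?_, ?_⟩ <;>
      · rw [symmDiff_symmDiff_cancel_right]; tauto
    · intro a ha
      simp only [Finset.mem_filter, Finset.mem_univ, true_and, Set.mem_inter_iff, Set.mem_univ, and_true] at ha ⊢
      exact ⟨FoldingFibre.mem_fibre.1 (FoldingFibre.symmDiff_mem_fibre (FoldingFibre.mem_fibre.2 ha.1)), ha.2.2, ha.2.1⟩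
    · intro a _
      exact symmDiff_symmDiff_cancel_right M a
    · intro a _
      exact symmDiff_symmDiff_cancel_right M a
  omega

omit [Fintype ι] in
/-- `(a ∆ M) \ M = a \ M`: reflecting inside `M` does not change a configuration off `M`. [folklore] -/
theorem symmDiff_sdiff_self (a M : Set ι) : (a ∆ M) \ M = a \ M := by
  ext x
  simp only [Set.mem_sdiff, Set.mem_symmDiff]
  tauto

/-- Swap symmetry at the level of indicator sums: `Σ_a [a \ M = u ∧ X a ∧ Y (a ∆ M)] = Σ_a [a \ M = u ∧ Y a ∧ X (a ∆ M)]`.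
[cite: Linusson2011, Prop. 2.6] [folklore] -/
theorem sum_pair_swap (M u : Set ι) (X Y : Set ι → Prop) :
    (∑ a : Set ι, (if a \ M = u ∧ X a ∧ Y (a ∆ M) then (1 : ℕ) else 0)) =
      ∑ a : Set ι, (if a \ M = u ∧ Y a ∧ X (a ∆ M) then (1 : ℕ) else 0) := by
  -- reindex the right-hand sum along the involution `a ↦ a ∆ M`
  let e : Set ι ≃ Set ι := ⟨fun a => a ∆ M, fun a => a ∆ M, fun a => symmDiff_symmDiff_cancel_right M a,
    fun a => symmDiff_symmDiff_cancel_right M a⟩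
  rw [← Equiv.sum_comp e (fun a => if a \ M = u ∧ Y a ∧ X (a ∆ M) then (1 : ℕ) else 0)]
  refine Finset.sum_congr rfl fun a _ => ?_
  have h1 : e a = a ∆ M := rfl
  rw [h1, symmDiff_sdiff_self, symmDiff_symmDiff_cancel_right]
  by_cases hf : a \ M = u <;> by_cases hx : X a <;> by_cases hy : Y (a ∆ M) <;> simp [hf, hx, hy]

/-- **Strata bookkeeping at one hard-core vertex (abstract).**  For arbitrary predicates `R` ("the cluster reaches `v`"), `UP`, `UQ` on
configurations and a folding fibre `(M, u)`: the PA-BERN-type inequality on the stratum "neither copy satisfies `R`" and the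
cross-reach inequality on the stratum "exactly the second copy satisfies `R`" together give the hard-core inequality on the union of
the strata "not both copies satisfy `R`" — the third stratum ("exactly the first copy") is the mirror image of the second under the
reflection `a ↦ a ∆ M`. [this work] -/
theorem hardCore_of_strata (M u : Set ι) (R UP UQ : Set ι → Prop)
    (hPA : (Finset.univ.filter fun a : Set ι =>
        a \ M = u ∧ (¬ R a ∧ UP a) ∧ (¬ R (a ∆ M) ∧ UQ (a ∆ M))).card ≤
      (Finset.univ.filter fun a : Set ι =>
        a \ M = u ∧ (¬ R a ∧ UP a ∧ UQ a) ∧ ¬ R (a ∆ M)).card)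
    (hX : (Finset.univ.filter fun a : Set ι =>
          a \ M = u ∧ (¬ R a ∧ UP a) ∧ (R (a ∆ M) ∧ UQ (a ∆ M))).card +
        (Finset.univ.filter fun a : Set ι =>
          a \ M = u ∧ (¬ R a ∧ UQ a) ∧ (R (a ∆ M) ∧ UP (a ∆ M))).card ≤
      (Finset.univ.filter fun a : Set ι =>
          a \ M = u ∧ (¬ R a ∧ UP a ∧ UQ a) ∧ R (a ∆ M)).card +
        (Finset.univ.filter fun a : Set ι =>
          a \ M = u ∧ ¬ R a ∧ (R (a ∆ M) ∧ UP (a ∆ M) ∧ UQ (a ∆ M))).card) :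
    (Finset.univ.filter fun a : Set ι =>
        a \ M = u ∧ ¬ (R a ∧ R (a ∆ M)) ∧ UP a ∧ UQ (a ∆ M)).card ≤
      (Finset.univ.filter fun a : Set ι =>
        a \ M = u ∧ ¬ (R a ∧ R (a ∆ M)) ∧ (UP a ∧ UQ a)).card := by
  simp only [Finset.card_filter] at hPA hX ⊢
  -- pointwise decomposition of both sides into the three strata
  have decL : ∀ a : Set ι, (if a \ M = u ∧ ¬ (R a ∧ R (a ∆ M)) ∧ UP a ∧ UQ (a ∆ M) then (1 : ℕ) else 0) =
      (if a \ M = u ∧ (¬ R a ∧ UP a) ∧ (¬ R (a ∆ M) ∧ UQ (a ∆ M)) then (1 : ℕ) else 0) +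
      (if a \ M = u ∧ (¬ R a ∧ UP a) ∧ (R (a ∆ M) ∧ UQ (a ∆ M)) then (1 : ℕ) else 0) +
      (if a \ M = u ∧ (R a ∧ UP a) ∧ (¬ R (a ∆ M) ∧ UQ (a ∆ M)) then (1 : ℕ) else 0) := by
    intro a
    by_cases hf : a \ M = u <;> by_cases h0 : R a <;> by_cases h1 : R (a ∆ M) <;> by_cases hp : UP a <;>
      by_cases hq : UQ (a ∆ M) <;> simp [hf, h0, h1, hp, hq]
  have decR : ∀ a : Set ι, (if a \ M = u ∧ ¬ (R a ∧ R (a ∆ M)) ∧ (UP a ∧ UQ a) then (1 : ℕ) else 0) =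
      (if a \ M = u ∧ (¬ R a ∧ UP a ∧ UQ a) ∧ ¬ R (a ∆ M) then (1 : ℕ) else 0) +
      (if a \ M = u ∧ (¬ R a ∧ UP a ∧ UQ a) ∧ R (a ∆ M) then (1 : ℕ) else 0) +
      (if a \ M = u ∧ (R a ∧ UP a ∧ UQ a) ∧ ¬ R (a ∆ M) then (1 : ℕ) else 0) := by
    intro a
    by_cases hf : a \ M = u <;> by_cases h0 : R a <;> by_cases h1 : R (a ∆ M) <;> by_cases hp : UP a <;>
      by_cases hq : UQ a <;> simp [hf, h0, h1, hp, hq]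
  rw [Finset.sum_congr rfl fun a _ => decL a, Finset.sum_congr rfl fun a _ => decR a,
    Finset.sum_add_distrib, Finset.sum_add_distrib, Finset.sum_add_distrib, Finset.sum_add_distrib]
  -- the two mirror identities (reflection `a ↦ a ∆ M`; `convert` absorbs the decidability instances) and linear arithmetic
  have sw1 : (∑ a : Set ι, if a \ M = u ∧ (R a ∧ UP a) ∧ (¬ R (a ∆ M) ∧ UQ (a ∆ M)) then (1 : ℕ) else 0) =
      ∑ a : Set ι, if a \ M = u ∧ (¬ R a ∧ UQ a) ∧ (R (a ∆ M) ∧ UP (a ∆ M)) then (1 : ℕ) else 0 := by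
    convert sum_pair_swap M u (fun a => R a ∧ UP a) (fun a => ¬ R a ∧ UQ a) using 3
  have sw2 : (∑ a : Set ι, if a \ M = u ∧ (R a ∧ UP a ∧ UQ a) ∧ ¬ R (a ∆ M) then (1 : ℕ) else 0) =
      ∑ a : Set ι, if a \ M = u ∧ ¬ R a ∧ (R (a ∆ M) ∧ UP (a ∆ M) ∧ UQ (a ∆ M)) then (1 : ℕ) else 0 := by
    convert sum_pair_swap M u (fun a => R a ∧ UP a ∧ UQ a) (fun a => ¬ R a) using 3
  omega

end OneCopy

/-! ## The three conjectures -/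

/-- **CONJECTURE "one-copy repulsion" (OPEN).**  For every `n`, source set `S`, repelled set `T`, increasing predicates `P, Q` of
edge sets (read on the union cluster `C_S`), and every folding fibre `(M, u)` (`u` disjoint from `M`): with `B = {S ↮ T}` imposed on
the FIRST copy only,
`N(B∩U_P ; U_Q) + N(B∩U_Q ; U_P) ≤ N(B∩U_P∩U_Q ; ⊤) + N(B ; U_P∩U_Q)`,
i.e. `Σ_{pairs (a, a∆M) of the fibre with a ∈ B} (1_P(a) − 1_P(a∆M))·(1_Q(a) − 1_Q(a∆M)) ≥ 0`.  Measure level = a theorem (BHK Thm 1.3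
+ Harris twice, module docstring); `T = ∅` = Harris fibrewise (`oneCopyRepelBHK_of_repel_empty`).  Exact census (lead gen 106): 0
violations on all graphs `n ≤ 5` and `n = 6, m ≤ 8` (connection events and OR/AND/size combinations, `|S| ≤ 2`, `|T| ≤ 2`); the
variants conditioning the first copy on `{S ↔ T}` or on a cluster-size event are FALSE (`n = 5`).
[cite: VandenbergHaggstromKahn2005, Thm. 1.3 (p. 6)] [cite: Linusson2011, Prop. 2.6] [status: open] -/
@[conjecture] def OneCopyRepelBHK : Prop :=
  ∀ (n : ℕ) (S T : Set (Fin n)) (P Q : Set (Sym2 (Fin n)) → Prop),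
    (∀ ⦃C C' : Set (Sym2 (Fin n))⦄, C ⊆ C' → P C → P C') →
    (∀ ⦃C C' : Set (Sym2 (Fin n))⦄, C ⊆ C' → Q C → Q C') →
    ∀ M u : Set (Sym2 (Fin n)), Disjoint u M →
      (Finset.univ.filter fun a : BondConfig (Fin n) =>
          a \ M = u ∧ (a ∈ {ω : BondConfig (Fin n) | ∀ s ∈ S, ∀ t ∈ T, ¬ (openGraph ω).Reachable s t} ∧
            P (⋃ s ∈ S, openEdgeCluster a s)) ∧ Q (⋃ s ∈ S, openEdgeCluster (a ∆ M) s)).card +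
      (Finset.univ.filter fun a : BondConfig (Fin n) =>
          a \ M = u ∧ (a ∈ {ω : BondConfig (Fin n) | ∀ s ∈ S, ∀ t ∈ T, ¬ (openGraph ω).Reachable s t} ∧
            Q (⋃ s ∈ S, openEdgeCluster a s)) ∧ P (⋃ s ∈ S, openEdgeCluster (a ∆ M) s)).card ≤
      (Finset.univ.filter fun a : BondConfig (Fin n) =>
          a \ M = u ∧ (a ∈ {ω : BondConfig (Fin n) | ∀ s ∈ S, ∀ t ∈ T, ¬ (openGraph ω).Reachable s t} ∧
            P (⋃ s ∈ S, openEdgeCluster a s) ∧ Q (⋃ s ∈ S, openEdgeCluster a s)) ∧ True).card +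
      (Finset.univ.filter fun a : BondConfig (Fin n) =>
          a \ M = u ∧ a ∈ {ω : BondConfig (Fin n) | ∀ s ∈ S, ∀ t ∈ T, ¬ (openGraph ω).Reachable s t} ∧
            (P (⋃ s ∈ S, openEdgeCluster (a ∆ M) s) ∧ Q (⋃ s ∈ S, openEdgeCluster (a ∆ M) s))).card

/-- **CONJECTURE "one-copy containment" (OPEN).**  As `OneCopyRepelBHK`, with the first copy conditioned to CONTAIN the vertex
set `A` in its cluster (`∀ x ∈ A, ∃ s ∈ S, s ↔ x`) instead of avoiding `T`:
`N(K∩U_P ; U_Q) + N(K∩U_Q ; U_P) ≤ N(K∩U_P∩U_Q ; ⊤) + N(K ; U_P∩U_Q)`, `K = {A ⊆ V(C_S)}`.  `A = ∅` = Harris fibrewise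
(`oneCopyContainBHK_of_empty`).  Exact census (lead gen 106): 0 violations on all graphs `n ≤ 5` and `n = 6, m ≤ 8` (`|A| ≤ 2`); the
variants conditioning on `{A ⊄ V(C_S)}` or on mixed containment/avoidance are FALSE (`n = 5`), and at measure level "positive
association given `S ↔ v`" is false, so this is not an instance of BHK's Theorem 1.3.
[cite: VandenbergHaggstromKahn2005, Thm. 1.3 (p. 6)] [cite: Linusson2011, Prop. 2.6] [status: open] -/
@[conjecture] def OneCopyContainBHK : Prop :=
  ∀ (n : ℕ) (S A : Set (Fin n)) (P Q : Set (Sym2 (Fin n)) → Prop),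
    (∀ ⦃C C' : Set (Sym2 (Fin n))⦄, C ⊆ C' → P C → P C') →
    (∀ ⦃C C' : Set (Sym2 (Fin n))⦄, C ⊆ C' → Q C → Q C') →
    ∀ M u : Set (Sym2 (Fin n)), Disjoint u M →
      (Finset.univ.filter fun a : BondConfig (Fin n) =>
          a \ M = u ∧ (a ∈ {ω : BondConfig (Fin n) | ∀ x ∈ A, ∃ s ∈ S, (openGraph ω).Reachable s x} ∧
            P (⋃ s ∈ S, openEdgeCluster a s)) ∧ Q (⋃ s ∈ S, openEdgeCluster (a ∆ M) s)).card +
      (Finset.univ.filter fun a : BondConfig (Fin n) =>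
          a \ M = u ∧ (a ∈ {ω : BondConfig (Fin n) | ∀ x ∈ A, ∃ s ∈ S, (openGraph ω).Reachable s x} ∧
            Q (⋃ s ∈ S, openEdgeCluster a s)) ∧ P (⋃ s ∈ S, openEdgeCluster (a ∆ M) s)).card ≤
      (Finset.univ.filter fun a : BondConfig (Fin n) =>
          a \ M = u ∧ (a ∈ {ω : BondConfig (Fin n) | ∀ x ∈ A, ∃ s ∈ S, (openGraph ω).Reachable s x} ∧
            P (⋃ s ∈ S, openEdgeCluster a s) ∧ Q (⋃ s ∈ S, openEdgeCluster a s)) ∧ True).card +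
      (Finset.univ.filter fun a : BondConfig (Fin n) =>
          a \ M = u ∧ a ∈ {ω : BondConfig (Fin n) | ∀ x ∈ A, ∃ s ∈ S, (openGraph ω).Reachable s x} ∧
            (P (⋃ s ∈ S, openEdgeCluster (a ∆ M) s) ∧ Q (⋃ s ∈ S, openEdgeCluster (a ∆ M) s))).card

/-- **CONJECTURE "cross-reach" (OPEN)** — the `w = 1` stratum at a hard-core vertex.  For every `n`, source set `S`, vertex `v`,
increasing predicates `P, Q` of edge sets (read on `C_S`) and every folding fibre: over the pairs `(a, a ∆ M)` in which the FIRST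
copy does NOT reach `v` from `S` and the SECOND copy DOES,
`N(U_P ; U_Q) + N(U_Q ; U_P) ≤ N(U_P∩U_Q ; ⊤) + N(⊤ ; U_P∩U_Q)` (counts restricted to that class), i.e.
`Σ_{class} (1_P(a) − 1_P(a∆M))(1_Q(a) − 1_Q(a∆M)) ≥ 0`.  With PA-BERN at `T = {v}` it yields the hard-core inequality (HC) at `N = {v}`
(`hardCoreBHK_single_of_crossReach_of_fibrewiseBHK`).  Exact census (lead gen 106): 0 violations on all graphs `n ≤ 5` (all extra
repelled sets) and `n = 6, m ≤ 8`; the complementary `w = 2` stratum ("both copies reach `v`") is NOT nonnegative (`n = 4`), but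
`w = 2` plus half of `w = 1` is (0 violations, same range).
[cite: VandenbergHaggstromKahn2005, Thm. 1.3 (p. 6), Thm. 1.1 (pp. 3–5)] [cite: Linusson2011, Prop. 2.6] [status: open] -/
@[conjecture] def CrossReachBHK : Prop :=
  ∀ (n : ℕ) (S : Set (Fin n)) (v : Fin n) (P Q : Set (Sym2 (Fin n)) → Prop),
    (∀ ⦃C C' : Set (Sym2 (Fin n))⦄, C ⊆ C' → P C → P C') →
    (∀ ⦃C C' : Set (Sym2 (Fin n))⦄, C ⊆ C' → Q C → Q C') →
    ∀ M u : Set (Sym2 (Fin n)), Disjoint u M →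
      (Finset.univ.filter fun a : BondConfig (Fin n) =>
          a \ M = u ∧ (¬ (∃ s ∈ S, (openGraph a).Reachable s v) ∧ P (⋃ s ∈ S, openEdgeCluster a s)) ∧
            ((∃ s ∈ S, (openGraph (a ∆ M)).Reachable s v) ∧ Q (⋃ s ∈ S, openEdgeCluster (a ∆ M) s))).card +
      (Finset.univ.filter fun a : BondConfig (Fin n) =>
          a \ M = u ∧ (¬ (∃ s ∈ S, (openGraph a).Reachable s v) ∧ Q (⋃ s ∈ S, openEdgeCluster a s)) ∧
            ((∃ s ∈ S, (openGraph (a ∆ M)).Reachable s v) ∧ P (⋃ s ∈ S, openEdgeCluster (a ∆ M) s))).card ≤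
      (Finset.univ.filter fun a : BondConfig (Fin n) =>
          a \ M = u ∧ (¬ (∃ s ∈ S, (openGraph a).Reachable s v) ∧
            P (⋃ s ∈ S, openEdgeCluster a s) ∧ Q (⋃ s ∈ S, openEdgeCluster a s)) ∧
            (∃ s ∈ S, (openGraph (a ∆ M)).Reachable s v)).card +
      (Finset.univ.filter fun a : BondConfig (Fin n) =>
          a \ M = u ∧ ¬ (∃ s ∈ S, (openGraph a).Reachable s v) ∧
            ((∃ s ∈ S, (openGraph (a ∆ M)).Reachable s v) ∧
              P (⋃ s ∈ S, openEdgeCluster (a ∆ M) s) ∧ Q (⋃ s ∈ S, openEdgeCluster (a ∆ M) s))).card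

/-! ## Kernel links -/

variable {n : ℕ}

/-- The union cluster `C_S` grows with the configuration. [folklore] -/
theorem iUnion_openEdgeCluster_mono (S : Set (Fin n)) ⦃ω ω' : BondConfig (Fin n)⦄ (h : ω ⊆ ω') :
    (⋃ s ∈ S, openEdgeCluster ω s) ⊆ (⋃ s ∈ S, openEdgeCluster ω' s) :=
  Set.iUnion₂_mono fun s _ => BHK2006.openEdgeCluster_mono h s

/-- **`OneCopyRepelBHK` holds when nothing is repelled (`T = ∅`)**: the class is the whole fibre and the statement is Harris
fibrewise in the two-sided form `OneCopy.harris_pair`. [cite: Kleitman1966, Lemma] [cite: Harris1960, Lemma 4.1] -/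
theorem oneCopyRepelBHK_of_repel_empty (S T : Set (Fin n)) (hT : T = ∅) (P Q : Set (Sym2 (Fin n)) → Prop)
    (hP : ∀ ⦃C C' : Set (Sym2 (Fin n))⦄, C ⊆ C' → P C → P C')
    (hQ : ∀ ⦃C C' : Set (Sym2 (Fin n))⦄, C ⊆ C' → Q C → Q C') (M u : Set (Sym2 (Fin n))) :
    (Finset.univ.filter fun a : BondConfig (Fin n) =>
        a \ M = u ∧ (a ∈ {ω : BondConfig (Fin n) | ∀ s ∈ S, ∀ t ∈ T, ¬ (openGraph ω).Reachable s t} ∧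
          P (⋃ s ∈ S, openEdgeCluster a s)) ∧ Q (⋃ s ∈ S, openEdgeCluster (a ∆ M) s)).card +
    (Finset.univ.filter fun a : BondConfig (Fin n) =>
        a \ M = u ∧ (a ∈ {ω : BondConfig (Fin n) | ∀ s ∈ S, ∀ t ∈ T, ¬ (openGraph ω).Reachable s t} ∧
          Q (⋃ s ∈ S, openEdgeCluster a s)) ∧ P (⋃ s ∈ S, openEdgeCluster (a ∆ M) s)).card ≤
    (Finset.univ.filter fun a : BondConfig (Fin n) =>
        a \ M = u ∧ (a ∈ {ω : BondConfig (Fin n) | ∀ s ∈ S, ∀ t ∈ T, ¬ (openGraph ω).Reachable s t} ∧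
          P (⋃ s ∈ S, openEdgeCluster a s) ∧ Q (⋃ s ∈ S, openEdgeCluster a s)) ∧ True).card +
    (Finset.univ.filter fun a : BondConfig (Fin n) =>
        a \ M = u ∧ a ∈ {ω : BondConfig (Fin n) | ∀ s ∈ S, ∀ t ∈ T, ¬ (openGraph ω).Reachable s t} ∧
          (P (⋃ s ∈ S, openEdgeCluster (a ∆ M) s) ∧ Q (⋃ s ∈ S, openEdgeCluster (a ∆ M) s))).card := by
  subst hT
  have hUP : IsUpperSet {ω : BondConfig (Fin n) | P (⋃ s ∈ S, openEdgeCluster ω s)} :=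
    fun ω ω' hle hω => hP (iUnion_openEdgeCluster_mono S hle) hω
  have hUQ : IsUpperSet {ω : BondConfig (Fin n) | Q (⋃ s ∈ S, openEdgeCluster ω s)} :=
    fun ω ω' hle hω => hQ (iUnion_openEdgeCluster_mono S hle) hω
  have key := OneCopy.harris_pair hUP hUQ M u
  simp only [Set.mem_setOf_eq, Set.mem_univ, true_and, and_true, Set.mem_empty_iff_false, false_implies,
    implies_true] at key ⊢
  exact key

/-- **`OneCopyContainBHK` holds when nothing has to be contained (`A = ∅`)**: Harris fibrewise, two-sided form.
[cite: Kleitman1966, Lemma] [cite: Harris1960, Lemma 4.1] -/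
theorem oneCopyContainBHK_of_empty (S A : Set (Fin n)) (hA : A = ∅) (P Q : Set (Sym2 (Fin n)) → Prop)
    (hP : ∀ ⦃C C' : Set (Sym2 (Fin n))⦄, C ⊆ C' → P C → P C')
    (hQ : ∀ ⦃C C' : Set (Sym2 (Fin n))⦄, C ⊆ C' → Q C → Q C') (M u : Set (Sym2 (Fin n))) :
    (Finset.univ.filter fun a : BondConfig (Fin n) =>
        a \ M = u ∧ (a ∈ {ω : BondConfig (Fin n) | ∀ x ∈ A, ∃ s ∈ S, (openGraph ω).Reachable s x} ∧
          P (⋃ s ∈ S, openEdgeCluster a s)) ∧ Q (⋃ s ∈ S, openEdgeCluster (a ∆ M) s)).card +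
    (Finset.univ.filter fun a : BondConfig (Fin n) =>
        a \ M = u ∧ (a ∈ {ω : BondConfig (Fin n) | ∀ x ∈ A, ∃ s ∈ S, (openGraph ω).Reachable s x} ∧
          Q (⋃ s ∈ S, openEdgeCluster a s)) ∧ P (⋃ s ∈ S, openEdgeCluster (a ∆ M) s)).card ≤
    (Finset.univ.filter fun a : BondConfig (Fin n) =>
        a \ M = u ∧ (a ∈ {ω : BondConfig (Fin n) | ∀ x ∈ A, ∃ s ∈ S, (openGraph ω).Reachable s x} ∧
          P (⋃ s ∈ S, openEdgeCluster a s) ∧ Q (⋃ s ∈ S, openEdgeCluster a s)) ∧ True).card +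
    (Finset.univ.filter fun a : BondConfig (Fin n) =>
        a \ M = u ∧ a ∈ {ω : BondConfig (Fin n) | ∀ x ∈ A, ∃ s ∈ S, (openGraph ω).Reachable s x} ∧
          (P (⋃ s ∈ S, openEdgeCluster (a ∆ M) s) ∧ Q (⋃ s ∈ S, openEdgeCluster (a ∆ M) s))).card := by
  subst hA
  have hUP : IsUpperSet {ω : BondConfig (Fin n) | P (⋃ s ∈ S, openEdgeCluster ω s)} :=
    fun ω ω' hle hω => hP (iUnion_openEdgeCluster_mono S hle) hω
  have hUQ : IsUpperSet {ω : BondConfig (Fin n) | Q (⋃ s ∈ S, openEdgeCluster ω s)} :=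
    fun ω ω' hle hω => hQ (iUnion_openEdgeCluster_mono S hle) hω
  have key := OneCopy.harris_pair hUP hUQ M u
  simp only [Set.mem_setOf_eq, Set.mem_univ, true_and, and_true, Set.mem_empty_iff_false, false_implies,
    implies_true] at key ⊢
  exact key

/-- **KERNEL LINK — at a single hard-core vertex, (HC) follows from PA-BERN and cross-reach.**  `CrossReachBHK` (the `w = 1`
stratum) and `FibrewiseBHK` at `T = {v}` (the `w = 0` stratum) imply, fibre by fibre, the hard-core two-copy BHK inequality
`Consts.HardCoreBHK` at `T = ∅`, `N = {v}` (stated literally: the conclusion is the body of `Consts.HardCoreBHK` with these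
parameters).  Proof: `OneCopy.hardCore_of_strata` — the hard-core class `{not both copies reach v}` is the disjoint union of the
strata `w = 0`, `(miss, reach)` and `(reach, miss)`, and the last is the mirror image of the second. [this work]
[cite: VandenbergHaggstromKahn2005, Thm. 1.3 (p. 6), Thm. 1.1 (pp. 3–5)] [cite: Linusson2011, Prop. 2.6] -/
theorem hardCoreBHK_single_of_crossReach_of_fibrewiseBHK (hX : CrossReachBHK) (hPA : FibrewiseBHK) (S : Set (Fin n))
    (v : Fin n) (P Q : Set (Sym2 (Fin n)) → Prop) (hP : ∀ ⦃C C' : Set (Sym2 (Fin n))⦄, C ⊆ C' → P C → P C')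
    (hQ : ∀ ⦃C C' : Set (Sym2 (Fin n))⦄, C ⊆ C' → Q C → Q C') (M u : Set (Sym2 (Fin n))) (hu : Disjoint u M) :
    (Finset.univ.filter fun a : BondConfig (Fin n) =>
        a \ M = u ∧
          (∀ w ∈ ({v} : Set (Fin n)),
            ¬ ((∃ s ∈ S, (openGraph a).Reachable s w) ∧ (∃ s ∈ S, (openGraph (a ∆ M)).Reachable s w))) ∧
          a ∈ ({ω : BondConfig (Fin n) | ∀ s ∈ S, ∀ t ∈ (∅ : Set (Fin n)), ¬ (openGraph ω).Reachable s t} ∩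
                {ω | P (⋃ s ∈ S, openEdgeCluster ω s)}) ∧
          a ∆ M ∈ ({ω : BondConfig (Fin n) | ∀ s ∈ S, ∀ t ∈ (∅ : Set (Fin n)), ¬ (openGraph ω).Reachable s t} ∩
                {ω | Q (⋃ s ∈ S, openEdgeCluster ω s)})).card ≤
    (Finset.univ.filter fun a : BondConfig (Fin n) =>
        a \ M = u ∧
          (∀ w ∈ ({v} : Set (Fin n)),
            ¬ ((∃ s ∈ S, (openGraph a).Reachable s w) ∧ (∃ s ∈ S, (openGraph (a ∆ M)).Reachable s w))) ∧
          a ∈ ({ω : BondConfig (Fin n) | ∀ s ∈ S, ∀ t ∈ (∅ : Set (Fin n)), ¬ (openGraph ω).Reachable s t} ∩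
                {ω | P (⋃ s ∈ S, openEdgeCluster ω s)} ∩ {ω | Q (⋃ s ∈ S, openEdgeCluster ω s)}) ∧
          a ∆ M ∈ {ω : BondConfig (Fin n) | ∀ s ∈ S, ∀ t ∈ (∅ : Set (Fin n)), ¬ (openGraph ω).Reachable s t}).card := by
  have h1 := hPA n S ({v} : Set (Fin n)) P Q hP hQ M u hu
  have h2 := hX n S v P Q hP hQ M u hu
  simp only [Set.mem_inter_iff, Set.mem_setOf_eq, Set.mem_singleton_iff, Set.mem_empty_iff_false, forall_eq,
    false_implies, implies_true, true_and, and_true, and_assoc, not_exists, not_and] at h1 h2 ⊢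
  have key := OneCopy.hardCore_of_strata M u (fun a : BondConfig (Fin n) => ∃ s ∈ S, (openGraph a).Reachable s v)
      (fun a => P (⋃ s ∈ S, openEdgeCluster a s)) (fun a => Q (⋃ s ∈ S, openEdgeCluster a s))
      (by simpa only [and_assoc, not_exists, not_and] using h1) (by simpa only [and_assoc, not_exists, not_and] using h2)
  simpa only [and_assoc, not_exists, not_and] using key

/-- **COROLLARY — the `T = ∅, |N| = 1` slice of `Consts.HardCoreBHK` from the two conjectures.**  If PA-BERN (`FibrewiseBHK`) and
cross-reach hold, then so does hard-core Harris at every single hard-core vertex (every graph, every fibre); by the reduction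
theorem `Consts.HardCoreReduction.hardCoreBHK_iff_hardCoreHarris` the general-`N` slice is what remains. [this work] -/
theorem hardCoreBHK_of_singleton (hX : CrossReachBHK) (hPA : FibrewiseBHK) (S T N : Set (Fin n)) (v : Fin n)
    (hT : T = ∅) (hN : N = {v}) (P Q : Set (Sym2 (Fin n)) → Prop)
    (hP : ∀ ⦃C C' : Set (Sym2 (Fin n))⦄, C ⊆ C' → P C → P C')
    (hQ : ∀ ⦃C C' : Set (Sym2 (Fin n))⦄, C ⊆ C' → Q C → Q C') (M u : Set (Sym2 (Fin n))) (hu : Disjoint u M) :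
    (Finset.univ.filter fun a : BondConfig (Fin n) =>
        a \ M = u ∧
          (∀ v ∈ N, ¬ ((∃ s ∈ S, (openGraph a).Reachable s v) ∧ (∃ s ∈ S, (openGraph (a ∆ M)).Reachable s v))) ∧
          a ∈ ({ω : BondConfig (Fin n) | ∀ s ∈ S, ∀ t ∈ T, ¬ (openGraph ω).Reachable s t} ∩
                {ω | P (⋃ s ∈ S, openEdgeCluster ω s)}) ∧
          a ∆ M ∈ ({ω : BondConfig (Fin n) | ∀ s ∈ S, ∀ t ∈ T, ¬ (openGraph ω).Reachable s t} ∩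
                {ω | Q (⋃ s ∈ S, openEdgeCluster ω s)})).card ≤
    (Finset.univ.filter fun a : BondConfig (Fin n) =>
        a \ M = u ∧
          (∀ v ∈ N, ¬ ((∃ s ∈ S, (openGraph a).Reachable s v) ∧ (∃ s ∈ S, (openGraph (a ∆ M)).Reachable s v))) ∧
          a ∈ ({ω : BondConfig (Fin n) | ∀ s ∈ S, ∀ t ∈ T, ¬ (openGraph ω).Reachable s t} ∩
                {ω | P (⋃ s ∈ S, openEdgeCluster ω s)} ∩ {ω | Q (⋃ s ∈ S, openEdgeCluster ω s)}) ∧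
          a ∆ M ∈ {ω : BondConfig (Fin n) | ∀ s ∈ S, ∀ t ∈ T, ¬ (openGraph ω).Reachable s t}).card := by
  subst hT hN
  -- `convert` absorbs the (subsingleton) decidability instances synthesised for the variable `T`, `N`
  convert hardCoreBHK_single_of_crossReach_of_fibrewiseBHK hX hPA S v P Q hP hQ M u hu using 3

end Consts

end Summit.CriticalPhenomena.PercolationContinuityZ3.Theorems
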